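import Literature.AlgebraicGeometry.Motives.AbelianVarietyTranslation
import Literature.AlgebraicGeometry.Motives.AbelianVarietyDegreeGrowth
import Literature.AlgebraicGeometry.Motives.RatFnFlatDescent
import Mathlib.FieldTheory.Fixed
import Mathlib.AlgebraicGeometry.Morphisms.Affine
import HarnessLib

/-!
# The Kummer bound: divisor classes killed by `[n]^*` number at most `#A[n](K)`

Let `A` be an abelian variety over a field `K` and `0 < n` with `[n]_A` dominant, flat and
surjective (an isogeny) such that `[K(A) : [n]^♯ K(A)] = #A[n](K) < ∞` — e.g. `K` algebraically
closed and `n` invertible in `K`, where both sides are `n^{2g}` (Mumford, *Abelian Varieties*, §6,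
App. 3 / Görtz–Wedhorn II, Prop. 27.186–27.188; in the tree: `kerRank_zsmul_id`,
`natCard_torsionPoints_of_isAlgClosed`, `IsIsogeny.kerRank_eq_finrank_functionFieldOver`). Then
**pairwise non-equivalent Cartier divisors `E` with `[n]^* E ∼ 0` number at most `#A[n](K)`**
(`AbelianVariety.card_le_natCard_torsionPoints_of_pullback_linEquiv_zero`). This is the
duality-free content of "`ker([n]^* : Pic⁰(A) → Pic⁰(A))` has order `n^{2g}`" (Mumford §15, proof
of Thm. 1, via the Kummer theory of the Galois cover `[n] : A → A` with group `A[n]`; Milne 1986,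
§8 / proof of Prop. 12.? "`[n]^* : Pic⁰ → Pic⁰`"), which is what the torsion count in Poincaré's
reducibility theorem needs (`Motives/AbelianVarietyPoincare*`, in preparation).

Proof (all proved here, no named facts):

* `translFF P = t_P^♯` — translations act on `K(A)` (`translFF_mul`, `translFF_one`), commuting with
  `[n]^♯` for `P ∈ A[n](K)` (`translFF_functionFieldMap_zsmul`);
* `eq_one_of_translFF_eq_id` — **torsion translations act faithfully on `K(A)`**: if `P^n = 1` and
  `t_P^♯ = id`, the affine open `V = ⋂_{k<n} t_{P^k}⁻¹U` (`A` separated, Mathlib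
  `IsAffineOpen.iInf`) is mapped into itself by `t_P` with `t_P|_V^♯ = id` on `Γ(V) ⊆ K(A)`, so
  `t_P|_V = id` (`V` affine) and the `V`-valued point `V ↪ A` is fixed by `t_P`, forcing `P = 1`
  (`eq_one_of_comp_translation_left_eq`: on `T`-points `t_P` is multiplication by the constant point);
* `exists_functionFieldMap_eq_of_forall_translFF_eq` — **Artin**: `A[n](K)` embeds into
  `Aut(K(A) / [n]^♯K(A))` (faithfulness), its fixed field has codegree `#A[n](K) = [K(A) : [n]^♯K(A)]`
  (Mathlib `IntermediateField.finrank_fixedField_eq_card`), hence is `[n]^♯ K(A)`: invariant rational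
  functions descend along `[n]`;
* `kummerChar` — for `[n]^*E ∼ 0` with trivializer `h` (`[n]^*E + div h = 0`), `σ ↦ t_σ^♯h / h` is a
  character `A[n](K) → K(A)ˣ`: its values are units at every point (`isUnitAt_translFF_div`), hence
  pulled back from `Spec K` (`RatFn.exists_functionFieldMap_eq_of_forall_isRegularAt_genericFibre`) and
  fixed by all translations (`translFF_eq_self_of_forall_isUnitAt`);
* `linEquiv_of_kummerChar_eq` — equal characters give `h/h'` invariant, `= [n]^♯ g`, and then
  `f_i g / f'_j` is a unit on `U_i ∩ U'_j` because `[n]^♯` of it is a unit upstairs (regularity descends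
  along the flat surjective `[n]`, `RatFn.IsRegularAt.of_functionFieldMap`): `E ∼ E'`;
* Dedekind (`natCard_monoidHom_units_le`, Mathlib `linearIndependent_monoidHom`):
  `#Hom(A[n](K), K(A)ˣ) ≤ #A[n](K)`.

Mathlib searched (pin): `IntermediateField.fixedField`, `finrank_fixedField_eq_card`,
`IntermediateField.finrank_eq_one_iff`, `IntermediateField.mem_bot`, `Algebra.finrank_eq_of_equiv_equiv`,
`RingHom.rangeRestrictFieldEquiv`, `linearIndependent_monoidHom`, `LinearIndependent.finite`,
`LinearIndependent.fintype_card_le_finrank`, `Module.finrank_fintype_fun_eq_card`,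
`IsAffineOpen.iInf`, `Scheme.Hom.resLE` (+ `resLE_app_top`, `resLE_comp_ι`),
`Scheme.isoSpec_hom_naturality`, `germ_injective_of_isIntegral`, `Flat.epi_of_flat_of_surjective`
(all used). In this tree (used): `AbelianVariety.translation` API, `torsionPoints`, `comp_nsmul_id`,
`RatFn.functionFieldMap` (+ `_comp`, `_id`, `_ofSection`), `FunctionFieldOver`,
`RatFn.IsRegularAt.of_functionFieldMap`, `RatFn.exists_functionFieldMap_eq_of_forall_isRegularAt_genericFibre`,
`CartierDivisor.linEquiv_iff`/`pullback`.

## References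

* D. Mumford, *Abelian Varieties*, TIFR Studies in Mathematics 5, OUP (1970): §7 (the Galois
  cover `[n]`, Thm. p. 66 / Thm. 4 p. 72), §15 Thm. 1 (proof: `[n]^*` on `Pic⁰`). [MumfordAV1970]
* J. S. Milne, *Abelian Varieties*, in: Cornell–Silverman (eds.), *Arithmetic Geometry*, Springer
  (1986): §8 (isogenies, degree `= [K(A):K(B)]`), held copy PDF p. 185. [Milne1986AbelianVarieties]
* E. Artin, Galois theory: Mathlib `Mathlib/FieldTheory/Fixed.lean`, `Galois/Basic.lean`. [folklore]
-/

universe u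

open CategoryTheory CategoryTheory.Limits AlgebraicGeometry MonoidalCategory CartesianMonoidalCategory
open TopologicalSpace Topology

noncomputable section

namespace Literature.AlgebraicGeometry.Motives

open scoped MonObj
open RatFn

namespace AbelianVariety

variable {K : Type u} [Field K] (A : AbelianVariety K)

/-! ### Translations act on the function field -/

/-- The translation `t_P`, an automorphism, is dominant. [folklore] -/
instance isDominant_translation_left (P : A.Points K) : IsDominant (A.translation P).left :=
  inferInstance

/-- `t_P^♯ : K(A) → K(A)`, the action of the translation by `P` on rational functions. [folklore] -/
abbrev translFF (P : A.Points K) : A.X.left.functionField →+* A.X.left.functionField :=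
  functionFieldMap (A.translation P).left

/-- `t_{PQ}^♯ = t_P^♯ ∘ t_Q^♯` (`A` is commutative). [folklore] -/
theorem translFF_mul (P Q : A.Points K) : A.translFF (P * Q) = (A.translFF P).comp (A.translFF Q) := by
  unfold translFF
  have e : (A.translation (P * Q)).left = (A.translation P).left ≫ (A.translation Q).left := by
    rw [← Over.comp_left, translation_comp']
  haveI : IsDominant ((A.translation P).left ≫ (A.translation Q).left) := inferInstance
  rw [show functionFieldMap (A.translation (P * Q)).left =
      functionFieldMap ((A.translation P).left ≫ (A.translation Q).left) from by congr 1]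
  exact functionFieldMap_comp _ _

/-- `t_1^♯ = id`. [folklore] -/
theorem translFF_one : A.translFF 1 = RingHom.id _ := by
  unfold translFF
  rw [show functionFieldMap (A.translation 1).left = functionFieldMap (𝟙 A.X.left) from by
    congr 1; rw [translation_one]; rfl]
  exact functionFieldMap_id

/-- The rational function of `g^*(r)|_W` is `g^♯` of the rational function of `r` (the `appLE` form of
`RatFn.functionFieldMap_ofSection`). This one-line lemma is
`Literature.AlgebraicGeometry.Motives.CartierDivisor.CechCover.ofSection_appLE` of
`Motives/CechCoverDescentStage`, re-derived here to keep the Čech-descent development out of the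
imports. [folklore] -/
theorem ofSection_appLE {Y Z : Scheme.{u}} [IsIntegral Y] [IsIntegral Z] (g : Y ⟶ Z) [IsDominant g]
    {U : Z.Opens} {W : Y.Opens} (hU : genericPoint Z ∈ U) (hW : genericPoint Y ∈ W) (e : W ≤ g ⁻¹ᵁ U)
    (r : Γ(Z, U)) : ofSection hW (g.appLE U W e r) = functionFieldMap g (ofSection hU r) := by
  rw [Scheme.Hom.appLE, CommRingCat.comp_apply, ofSection_map, functionFieldMap_ofSection]

/-- For a `K`-morphism `f : X → Y` over `K`, `f ≫ toSpecOver Y = toSpecOver X`. [folklore] -/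
theorem comp_toSpecOver_eq' {X Y : SchemeOver K} (f : X ⟶ Y) : f ≫ toSpecOver Y = toSpecOver X := by
  ext1
  rw [Over.comp_left, toSpecOver_left, toSpecOver_left]
  exact Over.w f

/-- **A point of `A` fixed by a translation**: if a `T`-valued point `x : T → A` with `T → Spec K`
an epimorphism satisfies `x ≫ t_P = x`, then `P = 1`. [folklore] -/
theorem eq_one_of_comp_translation_left_eq {T : Scheme.{u}} (x : T ⟶ A.X.left) (P : A.Points K)
    (h : x ≫ (A.translation P).left = x) [Epi (x ≫ A.X.hom)] : P = 1 := by
  let T' : SchemeOver K := Over.mk (x ≫ A.X.hom)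
  let x' : T' ⟶ A.X := Over.homMk x rfl
  have h1 : x' ≫ A.translation P = x' := Over.OverMorphism.ext h
  unfold translation at h1
  rw [MonObj.comp_mul, Category.comp_id] at h1
  have h2 : x' ≫ toSpecOver A.X ≫ P = 1 := mul_right_cancel (h1.trans (one_mul x').symm)
  rw [← Category.assoc, comp_toSpecOver_eq'] at h2
  have : Epi (toSpecOver T') := by
    have : Epi (toSpecOver T').left := by
      change Epi (x ≫ A.X.hom)
      infer_instance
    exact Over.epi_of_epi_left _
  rw [← cancel_epi (toSpecOver T'), h2]
  exact (MonObj.comp_one _).symm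

/-- **Torsion translations act faithfully on the function field**: if `P ^ n = 1`, `0 < n`, and
`t_P^♯ = id` on `K(A)`, then `P = 1`. Proof: the nonempty affine open
`V = ⋂_{k < n} t_{P^k}⁻¹ U` (`U` affine; `A` is separated) is mapped into itself by `t_P`, and
`t_P|_V : V → V` induces the identity on `Γ(V, 𝒪) ⊆ K(A)`, hence is the identity (`V` affine);
so the `V`-valued point `V ↪ A` is fixed by `t_P`, forcing `P = 1`. [folklore] -/
theorem eq_one_of_translFF_eq_id (P : A.Points K) {n : ℕ} (hn : 0 < n) (hP : P ^ n = 1)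
    (h : A.translFF P = RingHom.id _) : P = 1 := by
  set t := (A.translation P).left with ht
  -- an affine open `U₀ ∋ e` and the opens `U k = t_{P^k}⁻¹ U₀`
  obtain ⟨_, ⟨U₀, hU₀, rfl⟩, heU₀, -⟩ :=
    A.X.left.isBasis_affineOpens.exists_subset_of_mem_open (Set.mem_univ (origin A)) isOpen_univ
  let U : ℕ → A.X.left.Opens := fun k => (A.translation (P ^ k)).left ⁻¹ᵁ U₀
  have hUaff : ∀ k, IsAffineOpen (U k) := fun k => hU₀.preimage _
  have hU0 : U 0 = U₀ := by
    change (A.translation (P ^ 0)).left ⁻¹ᵁ U₀ = U₀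
    rw [pow_zero, translation_one]; rfl
  have hUn : U n = U₀ := by
    change (A.translation (P ^ n)).left ⁻¹ᵁ U₀ = U₀
    rw [hP, translation_one]; rfl
  have htU : ∀ k, t ⁻¹ᵁ (U k) = U (k + 1) := fun k => by
    change (A.translation P).left ⁻¹ᵁ ((A.translation (P ^ k)).left ⁻¹ᵁ U₀) =
      (A.translation (P ^ (k + 1))).left ⁻¹ᵁ U₀
    rw [← Scheme.Hom.comp_preimage, ← Over.comp_left, translation_comp', ← pow_succ']
  -- `V = ⋂_{k < n} U k`, affine, nonempty, mapped into itself by `t`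
  haveI : Nonempty (Fin n) := ⟨⟨0, hn⟩⟩
  let V : A.X.left.Opens := ⨅ k : Fin n, U k.1
  have hVaff : IsAffineOpen V := IsAffineOpen.iInf fun k => hUaff k.1
  have hmemV : ∀ {v : A.X.left}, v ∈ V ↔ ∀ k : Fin n, v ∈ U k.1 := fun {v} => by
    rw [← SetLike.mem_coe, Opens.coe_iInf, Set.mem_iInter]
    rfl
  have hηU : ∀ k, genericPoint A.X.left ∈ U k := fun k => by
    haveI := irreducibleSpace_left A
    have hpt : (inv (A.translation (P ^ k)).left) (origin A) ∈ U k := by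
      change (A.translation (P ^ k)).left ((inv (A.translation (P ^ k)).left) (origin A)) ∈ U₀
      rw [← Scheme.Hom.comp_apply, IsIso.inv_hom_id]
      exact heU₀
    exact ((genericPoint_spec A.X.left).mem_open_set_iff (U k).isOpen).2 ⟨_, Set.mem_univ _, hpt⟩
  have hηV : genericPoint A.X.left ∈ V := hmemV.2 fun k => hηU k.1
  have hle : V ≤ t ⁻¹ᵁ V := by
    intro v hv
    change t v ∈ V
    refine hmemV.2 fun k => ?_
    have hv' : v ∈ t ⁻¹ᵁ (U k.1) := by
      rw [htU]
      by_cases hk : k.1 + 1 < n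
      · exact hmemV.1 hv ⟨k.1 + 1, hk⟩
      · have hk' : k.1 + 1 = n := by omega
        rw [hk', hUn, ← hU0]
        exact hmemV.1 hv ⟨0, hn⟩
    exact hv'
  -- `t|_V : V → V` is the identity
  haveI : IsAffine V := hVaff
  set r := t.resLE V V hle with hr
  have happ : t.appLE V V hle = 𝟙 _ := by
    ext a
    apply germ_injective_of_isIntegral A.X.left (genericPoint A.X.left) hηV
    change ofSection hηV (t.appLE V V hle a) = ofSection hηV a
    rw [ofSection_appLE t hηV hηV hle a]
    change A.translFF P (ofSection hηV a) = ofSection hηV a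
    rw [h]; rfl
  have hr1 : r = 𝟙 _ := by
    have hnat := Scheme.isoSpec_hom_naturality r
    have htop : r.appTop = 𝟙 _ := by
      change r.app ⊤ = 𝟙 _
      rw [hr, Scheme.Hom.resLE_app_top, happ, Category.id_comp, Iso.hom_inv_id]
    rw [htop, Spec.map_id, Category.comp_id] at hnat
    rw [← cancel_mono (Scheme.isoSpec (V : Scheme.{u})).hom, Category.id_comp]
    exact hnat.symm
  -- so `V ↪ A` is fixed by `t`
  have hfix : V.ι ≫ t = V.ι := by
    rw [← Scheme.Hom.resLE_comp_ι t hle, ← hr, hr1, Category.id_comp]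
  haveI : Epi (V.ι ≫ A.X.hom) := by
    haveI : Nonempty (V : Scheme.{u}) := ⟨⟨genericPoint A.X.left, hηV⟩⟩
    haveI : Surjective (V.ι ≫ A.X.hom) := ⟨fun p => ⟨Classical.arbitrary _, Subsingleton.elim _ _⟩⟩
    exact Flat.epi_of_flat_of_surjective _
  exact A.eq_one_of_comp_translation_left_eq V.ι P hfix

/-! ### The subfield `[n]^♯ K(A)` is the field of invariants of the `n`-torsion translations -/

section Galois

variable (n : ℕ)

/-- The `n`-torsion points act on `K(A)` by `K([n]^♯ K(A))`-algebra automorphisms `t_P^♯`.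
[folklore] -/
def translRingEquiv (P : A.Points K) : A.X.left.functionField ≃+* A.X.left.functionField :=
  RingEquiv.ofRingHom (A.translFF P) (A.translFF P⁻¹)
    (by rw [← translFF_mul, mul_inv_cancel, translFF_one])
    (by rw [← translFF_mul, inv_mul_cancel, translFF_one])

/-- `translRingEquiv P` is `t_P^♯`. [folklore] -/
@[simp] theorem translRingEquiv_apply (P : A.Points K) (f : A.X.left.functionField) :
    A.translRingEquiv P f = A.translFF P f := rfl

variable {n}

/-- Torsion translations commute with `[n]`: `t_P^♯ ∘ [n]^♯ = [n]^♯` for `P ^ n = 1`. [folklore] -/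
theorem translFF_functionFieldMap_zsmul [IsDominant (Hom.toSchemeHom ((n : ℤ) • 𝟙 A))]
    (P : A.Points K) (hP : P ^ n = 1) (g : A.X.left.functionField) :
    A.translFF P (functionFieldMap (Hom.toSchemeHom ((n : ℤ) • 𝟙 A)) g) =
      functionFieldMap (Hom.toSchemeHom ((n : ℤ) • 𝟙 A)) g := by
  have hcomm : A.translation P ≫ ((n : ℤ) • 𝟙 A).hom.hom.hom = ((n : ℤ) • 𝟙 A).hom.hom.hom := by
    unfold translation
    rw [MonObj.mul_comp, Category.id_comp, Category.assoc]
    have hPn : P ≫ ((n : ℤ) • 𝟙 A).hom.hom.hom = 1 := by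
      rw [natCast_zsmul, comp_nsmul_id, hP]
    rw [hPn, MonObj.comp_one, one_mul]
  have hcomm' : (A.translation P).left ≫ Hom.toSchemeHom ((n : ℤ) • 𝟙 A) =
      Hom.toSchemeHom ((n : ℤ) • 𝟙 A) := congrArg CommaMorphism.left hcomm
  haveI : IsDominant ((A.translation P).left ≫ Hom.toSchemeHom ((n : ℤ) • 𝟙 A)) := by
    rw [hcomm']; infer_instance
  have h := functionFieldMap_comp (Hom.toSchemeHom ((n : ℤ) • 𝟙 A)) (A.translation P).left
  have h' : functionFieldMap ((A.translation P).left ≫ Hom.toSchemeHom ((n : ℤ) • 𝟙 A)) =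
      functionFieldMap (Hom.toSchemeHom ((n : ℤ) • 𝟙 A)) := by congr 1
  rw [h'] at h
  exact (congrArg (fun φ => φ g) h).symm

variable (n) in
/-- The subfield `[n]^♯ K(A) ⊆ K(A)`. [folklore] -/
abbrev zsmulSubfield [IsDominant (Hom.toSchemeHom ((n : ℤ) • 𝟙 A))] : Subfield A.X.left.functionField :=
  (functionFieldMap (Hom.toSchemeHom ((n : ℤ) • 𝟙 A))).fieldRange

/-- **Invariant rational functions descend along `[n]`.** Let `0 < n`, `[n]_A` dominant with
`[K(A) : [n]^♯ K(A)] = #A[n](K) < ∞`. If `f ∈ K(A)` is fixed by `t_P^♯` for all `P ∈ A[n](K)`,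
then `f = [n]^♯ g` for some `g` (Artin: the `n`-torsion acts faithfully on `K(A)` —
`eq_one_of_translFF_eq_id` — by `[n]^♯ K(A)`-automorphisms, so the fixed field has codegree
`#A[n](K) = [K(A) : [n]^♯ K(A)]` and equals `[n]^♯ K(A)`). [folklore] -/
theorem exists_functionFieldMap_eq_of_forall_translFF_eq (hn : 0 < n)
    [IsDominant (Hom.toSchemeHom ((n : ℤ) • 𝟙 A))] [Finite (A.torsionPoints K n)]
    (hdeg : Module.finrank A.X.left.functionField
      (FunctionFieldOver (Hom.toSchemeHom ((n : ℤ) • 𝟙 A))) = Nat.card (A.torsionPoints K n))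
    {q : A.X.left.functionField} (hq : ∀ P ∈ A.torsionPoints K n, A.translFF P q = q) :
    ∃ g, functionFieldMap (Hom.toSchemeHom ((n : ℤ) • 𝟙 A)) g = q := by
  set φ := Hom.toSchemeHom ((n : ℤ) • 𝟙 A) with hφ
  let k : Subfield A.X.left.functionField := A.zsmulSubfield n
  letI : Algebra k A.X.left.functionField := k.toAlgebra
  -- torsion points have `P ^ n = 1`
  have hpow : ∀ P ∈ A.torsionPoints K n, P ^ n = 1 := fun P hP => by
    have := (mem_torsionPoints_iff _ _).1 hP
    rwa [zpow_natCast] at this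
  -- the action by `k`-algebra automorphisms
  have hfix : ∀ P ∈ A.torsionPoints K n, ∀ c : k, A.translFF P c = c := fun P hP c => by
    obtain ⟨g, hg⟩ := c.2
    rw [← hg]
    exact translFF_functionFieldMap_zsmul A P (hpow P hP) g
  let ρ : A.torsionPoints K n →* (A.X.left.functionField ≃ₐ[k] A.X.left.functionField) :=
    { toFun := fun P => AlgEquiv.ofRingEquiv (f := A.translRingEquiv P.1)
        (fun c => hfix P.1 P.2 c)
      map_one' := by
        ext x
        change A.translFF (1 : A.Points K) x = x
        rw [translFF_one]; rfl
      map_mul' := fun P Q => by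
        ext x
        change A.translFF (P.1 * Q.1) x = A.translFF P.1 (A.translFF Q.1 x)
        rw [translFF_mul]; rfl }
  have hρinj : Function.Injective ρ := by
    intro P Q hPQ
    have h1 : A.translFF (P.1 * Q.1⁻¹) = RingHom.id _ := by
      ext x
      have := AlgEquiv.congr_fun hPQ (A.translFF Q.1⁻¹ x)
      change A.translFF P.1 (A.translFF Q.1⁻¹ x) = A.translFF Q.1 (A.translFF Q.1⁻¹ x) at this
      rw [translFF_mul]
      change A.translFF P.1 (A.translFF Q.1⁻¹ x) = x
      rw [this, ← RingHom.comp_apply, ← translFF_mul, mul_inv_cancel, translFF_one]; rfl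
    have hmem : P.1 * Q.1⁻¹ ∈ A.torsionPoints K n := mul_mem P.2 (inv_mem Q.2)
    have h2 := A.eq_one_of_translFF_eq_id (P.1 * Q.1⁻¹) hn (hpow _ hmem) h1
    exact Subtype.ext (mul_inv_eq_one.1 h2)
  -- finite-dimensionality and the degree `[K(A) : k] = #A[n](K)`
  have hk : Module.finrank k A.X.left.functionField = Nat.card (A.torsionPoints K n) := by
    rw [← hdeg]
    symm
    refine Algebra.finrank_eq_of_equiv_equiv (R₀ := A.X.left.functionField) (S₀ := FunctionFieldOver φ) (R₁ := k) (S₁ := A.X.left.functionField)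
      (functionFieldMap φ).rangeRestrictFieldEquiv (FunctionFieldOver.of φ).symm ?_
    ext x
    rfl
  have hpos : 0 < Nat.card (A.torsionPoints K n) := Nat.card_pos
  haveI : FiniteDimensional k A.X.left.functionField := Module.finite_of_finrank_pos (by rw [hk]; exact hpos)
  -- the fixed field of the image `H` of `A[n](K)` in `Aut(K(A)/k)` is `⊥ = k`
  set H : Subgroup (A.X.left.functionField ≃ₐ[k] A.X.left.functionField) := ρ.range with hH
  have hcardH : Nat.card H = Nat.card (A.torsionPoints K n) :=
    (Nat.card_congr (MonoidHom.ofInjective hρinj).toEquiv).symm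
  have hfin : Module.finrank (IntermediateField.fixedField H) A.X.left.functionField = Nat.card H :=
    IntermediateField.finrank_fixedField_eq_card H
  have htower := Module.finrank_mul_finrank k (IntermediateField.fixedField H) A.X.left.functionField
  rw [hfin, hcardH, hk] at htower
  have h1 : Module.finrank k (IntermediateField.fixedField H) = 1 :=
    Nat.eq_of_mul_eq_mul_right hpos (htower.trans (one_mul _).symm)
  have hbot : IntermediateField.fixedField H = ⊥ := IntermediateField.finrank_eq_one_iff.1 h1
  -- `q` is fixed by `H`, hence lies in `k`
  have hqH : q ∈ IntermediateField.fixedField H := by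
    rw [IntermediateField.mem_fixedField_iff]
    rintro _ ⟨P, rfl⟩
    exact hq P.1 P.2
  rw [hbot, IntermediateField.mem_bot] at hqH
  obtain ⟨⟨_, g, rfl⟩, hg⟩ := hqH
  exact ⟨g, hg⟩

end Galois

/-! ### The Kummer character of a divisor class killed by `[n]^*` -/

section Kummer

variable {n : ℕ}

/-- The number of characters of a finite group into a domain is at most the order of the group
(Dedekind's independence of characters, Mathlib `linearIndependent_monoidHom`). [folklore] -/
theorem natCard_monoidHom_units_le {G : Type*} [Group G] [Finite G] (L : Type*) [Field L] :
    Nat.card (G →* Lˣ) ≤ Nat.card G := by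
  classical
  haveI := Fintype.ofFinite G
  have hli := linearIndependent_monoidHom G L
  haveI : Finite (G →* L) := hli.finite
  haveI := Fintype.ofFinite (G →* L)
  have h1 : Fintype.card (G →* L) ≤ Module.finrank L (G → L) := hli.fintype_card_le_finrank
  rw [Module.finrank_fintype_fun_eq_card] at h1
  have h2 : Nat.card (G →* Lˣ) ≤ Nat.card (G →* L) := by
    refine Nat.card_le_card_of_injective (fun χ => (Units.coeHom L).comp χ) (fun χ χ' h => ?_)
    ext g
    exact congrArg (fun φ : G →* L => φ g) h
  rw [Nat.card_eq_fintype_card (α := G), Nat.card_eq_fintype_card (α := G →* L)] at *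
  exact h2.trans h1

variable [IsDominant (Hom.toSchemeHom ((n : ℤ) • 𝟙 A))]

/-- A **trivializer** of `[n]^* E`: a rational function `h ≠ 0` with `[n]^♯(f_i) · h` a unit on
`[n]⁻¹ U_i`, i.e. `[n]^* E + div(h) = 0` as divisors; it exists iff `[n]^* E ∼ 0`. [folklore] -/
def IsTrivializer (E : CartierDivisor A.X.left) (h : A.X.left.functionField) : Prop :=
  h ≠ 0 ∧ ∀ (i : E.ι) (x : A.X.left), Hom.toSchemeHom ((n : ℤ) • 𝟙 A) x ∈ E.U i →
    IsUnitAt x (functionFieldMap (Hom.toSchemeHom ((n : ℤ) • 𝟙 A)) (E.f i) * h)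

omit [IsDominant (Hom.toSchemeHom ((n : ℤ) • 𝟙 A))] in
/-- `[n]^* E ∼ 0` gives a trivializer. [folklore] -/
theorem exists_isTrivializer [IsDominant (Hom.toSchemeHom ((n : ℤ) • 𝟙 A))]
    {E : CartierDivisor A.X.left}
    (hE : (E.pullback (Hom.toSchemeHom ((n : ℤ) • 𝟙 A))).LinEquiv 0) :
    ∃ h, A.IsTrivializer (n := n) E h := by
  obtain ⟨h, hh, H⟩ := (CartierDivisor.linEquiv_iff _ _).1 hE
  refine ⟨h, hh, fun i x hx => ?_⟩
  have := H i ⟨⟩ x hx (CartierDivisor.mem_zero_U _ _)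
  rwa [CartierDivisor.zero_f, div_one, CartierDivisor.pullback_f] at this

variable {A}

/-- For a trivializer `h` of `[n]^* E` and an `n`-torsion point `σ`, the rational function
`t_σ^♯ h / h` is a unit at every point (both `[n]^♯(f_i) · h` and its `t_σ^♯`-translate
`[n]^♯(f_i) · t_σ^♯ h` are units on `[n]⁻¹ U_i`, which is `t_σ`-stable). [folklore] -/
theorem isUnitAt_translFF_div {E : CartierDivisor A.X.left} {h : A.X.left.functionField}
    (hh : A.IsTrivializer (n := n) E h) {σ : A.Points K} (hσ : σ ^ n = 1) (x : A.X.left) :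
    IsUnitAt x (A.translFF σ h / h) := by
  obtain ⟨i, hi⟩ := E.covers ((Hom.toSchemeHom ((n : ℤ) • 𝟙 A)) x)
  have h1 : IsUnitAt x (functionFieldMap (Hom.toSchemeHom ((n : ℤ) • 𝟙 A)) (E.f i) * h) := hh.2 i x hi
  -- `t_σ x` lies over the same point of `U_i`
  have hcomm : (A.translation σ).left ≫ (Hom.toSchemeHom ((n : ℤ) • 𝟙 A)) = (Hom.toSchemeHom ((n : ℤ) • 𝟙 A)) := by
    have : A.translation σ ≫ ((n : ℤ) • 𝟙 A).hom.hom.hom = ((n : ℤ) • 𝟙 A).hom.hom.hom := by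
      unfold translation
      rw [MonObj.mul_comp, Category.id_comp, Category.assoc, natCast_zsmul, comp_nsmul_id, hσ,
        MonObj.comp_one, one_mul]
    exact congrArg CommaMorphism.left this
  have hi' : (Hom.toSchemeHom ((n : ℤ) • 𝟙 A)) ((A.translation σ).left x) ∈ E.U i := by
    rw [← Scheme.Hom.comp_apply, hcomm]; exact hi
  have h2 : IsUnitAt x (A.translFF σ (functionFieldMap (Hom.toSchemeHom ((n : ℤ) • 𝟙 A)) (E.f i) * h)) :=
    (hh.2 i _ hi').functionFieldMap
  rw [map_mul] at h2
  change IsUnitAt x (A.translFF σ (functionFieldMap (Hom.toSchemeHom ((n : ℤ) • 𝟙 A)) (E.f i)) * A.translFF σ h) at h2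
  rw [translFF_functionFieldMap_zsmul A σ hσ] at h2
  have h3 := h2.div h1
  have hne : functionFieldMap (Hom.toSchemeHom ((n : ℤ) • 𝟙 A)) (E.f i) ≠ 0 := (map_ne_zero _).2 (E.f_ne_zero i)
  convert h3 using 1
  field_simp

/-- **Everywhere-unit rational functions on `A` are constant**, in the form: they are pulled back
from `Spec K` (`RatFn.exists_functionFieldMap_eq_of_forall_isRegularAt_genericFibre`), hence
**fixed by every translation**. [folklore] -/
theorem translFF_eq_self_of_forall_isUnitAt {u : A.X.left.functionField}
    (hu : ∀ x : A.X.left, IsUnitAt x u) (τ : A.Points K) : A.translFF τ u = u := by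
  haveI : UniversallyClosed A.X.hom := inferInstance
  obtain ⟨e, he⟩ := exists_functionFieldMap_eq_of_forall_isRegularAt_genericFibre A.X.hom (unitPt A)
    (unitPt_comp_hom (B := A)) (u := u) (fun w _ => (hu w).isRegularAt)
  rw [← he]
  have hw : (A.translation τ).left ≫ A.X.hom = A.X.hom := Over.w _
  haveI : IsDominant ((A.translation τ).left ≫ A.X.hom) := by rw [hw]; infer_instance
  have hc := functionFieldMap_comp A.X.hom (A.translation τ).left
  have hc' : functionFieldMap ((A.translation τ).left ≫ A.X.hom) = functionFieldMap A.X.hom := by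
    congr 1
  rw [hc'] at hc
  exact (congrArg (fun ψ => ψ e) hc).symm

/-- **The Kummer character** `χ_E : A[n](K) → K(A)ˣ`, `σ ↦ t_σ^♯ h / h`, of a divisor `E` with
`[n]^* E ∼ 0` and trivializer `h` (its values are constants: everywhere units). [folklore] -/
def kummerChar {E : CartierDivisor A.X.left} {h : A.X.left.functionField}
    (hh : A.IsTrivializer (n := n) E h) : A.torsionPoints K n →* (A.X.left.functionField)ˣ where
  toFun σ := Units.mk0 (A.translFF σ.1 h / h)
    (div_ne_zero ((map_ne_zero _).2 hh.1) hh.1)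
  map_one' := by
    ext
    change A.translFF (1 : A.Points K) h / h = 1
    rw [translFF_one, RingHom.id_apply, div_self hh.1]
  map_mul' σ τ := by
    ext
    change A.translFF (σ.1 * τ.1) h / h = A.translFF σ.1 h / h * (A.translFF τ.1 h / h)
    have hτ : τ.1 ^ n = 1 := by
      have := (mem_torsionPoints_iff _ _).1 τ.2; rwa [zpow_natCast] at this
    have hfix : A.translFF σ.1 (A.translFF τ.1 h / h) = A.translFF τ.1 h / h :=
      translFF_eq_self_of_forall_isUnitAt (isUnitAt_translFF_div hh hτ) σ.1
    have hne : A.translFF σ.1 h ≠ 0 := (map_ne_zero _).2 hh.1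
    rw [map_div₀] at hfix
    rw [translFF_mul, RingHom.comp_apply]
    have e1 : A.translFF σ.1 (A.translFF τ.1 h) = A.translFF τ.1 h / h * A.translFF σ.1 h := by
      rw [← hfix, div_mul_cancel₀ _ hne]
    rw [e1]
    field_simp

/-- The value of the Kummer character. [folklore] -/
theorem kummerChar_apply {E : CartierDivisor A.X.left} {h : A.X.left.functionField}
    (hh : A.IsTrivializer (n := n) E h) (σ : A.torsionPoints K n) :
    (kummerChar hh σ : A.X.left.functionField) = A.translFF σ.1 h / h := rfl

/-- **Divisors with the same Kummer character are linearly equivalent** (`0 < n`, `[n]` flat,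
surjective, with `[K(A) : [n]^♯K(A)] = #A[n](K) < ∞`): `h / h'` is invariant under the
`n`-torsion translations, hence `= [n]^♯ g` (`exists_functionFieldMap_eq_of_forall_translFF_eq`),
and then `[n]^♯(f_i · g / f'_j)` is a unit on `[n]⁻¹(U_i ∩ U'_j)`, so `f_i · g / f'_j` is a unit
on `U_i ∩ U'_j` (regularity descends along the flat surjective `[n]`,
`RatFn.IsRegularAt.of_functionFieldMap`), i.e. `E ∼ E'`. [folklore] -/
theorem linEquiv_of_kummerChar_eq (hn : 0 < n) [Flat (Hom.toSchemeHom ((n : ℤ) • 𝟙 A))]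
    [Surjective (Hom.toSchemeHom ((n : ℤ) • 𝟙 A))] [Finite (A.torsionPoints K n)]
    (hdeg : Module.finrank A.X.left.functionField
      (FunctionFieldOver (Hom.toSchemeHom ((n : ℤ) • 𝟙 A))) = Nat.card (A.torsionPoints K n))
    {E E' : CartierDivisor A.X.left} {h h' : A.X.left.functionField}
    (hh : A.IsTrivializer (n := n) E h) (hh' : A.IsTrivializer (n := n) E' h')
    (heq : kummerChar hh = kummerChar hh') : E.LinEquiv E' := by
  -- `q = h / h'` is invariant
  have hinv : ∀ P ∈ A.torsionPoints K n, A.translFF P (h / h') = h / h' := fun P hP => by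
    have e := congrArg (fun χ : A.torsionPoints K n →* (A.X.left.functionField)ˣ =>
      ((χ ⟨P, hP⟩ : (A.X.left.functionField)ˣ) : A.X.left.functionField)) heq
    simp only [kummerChar_apply] at e
    rw [map_div₀]
    rw [div_eq_div_iff hh.1 hh'.1] at e
    rw [div_eq_div_iff ((map_ne_zero _).2 hh'.1) hh'.1]
    linear_combination e
  obtain ⟨g, hg⟩ := A.exists_functionFieldMap_eq_of_forall_translFF_eq hn hdeg hinv
  have hg0 : g ≠ 0 := by
    rintro rfl
    rw [map_zero, eq_comm, div_eq_zero_iff] at hg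
    exact hg.elim hh.1 hh'.1
  -- `E ∼ E'` via `g`
  rw [CartierDivisor.linEquiv_iff]
  refine ⟨g, hg0, fun i j y hi hj => ?_⟩
  obtain ⟨x, rfl⟩ := (Hom.toSchemeHom ((n : ℤ) • 𝟙 A)).surjective y
  have h1 : IsUnitAt x (functionFieldMap (Hom.toSchemeHom ((n : ℤ) • 𝟙 A)) (E.f i) * h) := hh.2 i x hi
  have h2 : IsUnitAt x (functionFieldMap (Hom.toSchemeHom ((n : ℤ) • 𝟙 A)) (E'.f j) * h') := hh'.2 j x hj
  have h3 : IsUnitAt x (functionFieldMap (Hom.toSchemeHom ((n : ℤ) • 𝟙 A)) (E.f i * g / E'.f j)) := by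
    rw [map_div₀, map_mul, hg]
    convert h1.div h2 using 1
    field_simp
  -- descend along the flat morphism `[n]`
  have hreg : IsRegularAt ((Hom.toSchemeHom ((n : ℤ) • 𝟙 A)) x) (E.f i * g / E'.f j) :=
    IsRegularAt.of_functionFieldMap (Hom.toSchemeHom ((n : ℤ) • 𝟙 A)) h3.isRegularAt
  have hreg' : IsRegularAt ((Hom.toSchemeHom ((n : ℤ) • 𝟙 A)) x) (E.f i * g / E'.f j)⁻¹ := by
    refine IsRegularAt.of_functionFieldMap (Hom.toSchemeHom ((n : ℤ) • 𝟙 A)) ?_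
    rw [map_inv₀]
    exact ((isUnitAt_iff.1 h3).2.2)
  have hne : E.f i * g / E'.f j ≠ 0 :=
    div_ne_zero (mul_ne_zero (E.f_ne_zero i) hg0) (E'.f_ne_zero j)
  exact isUnitAt_iff.2 ⟨hne, hreg, hreg'⟩

/-- **Kummer bound.** For `0 < n` with `[n]_A` flat, surjective and
`[K(A) : [n]^♯ K(A)] = #A[n](K) < ∞`: pairwise non-equivalent Cartier divisors `E_i`, `i ∈ s`,
with `[n]^* E_i ∼ 0` number at most `#A[n](K)` — their Kummer characters are pairwise distinct
characters `A[n](K) → K(A)ˣ`, of which there are at most `#A[n](K)` (Dedekind). This is the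
dual-free form of "`#ker([n]^* : Pic⁰ → Pic⁰) ≤ n^{2g}`" (Mumford, *Abelian Varieties*, §15
Thm. 1 / Kummer theory of the étale cover `[n]`). [folklore] -/
theorem card_le_natCard_torsionPoints_of_pullback_linEquiv_zero (hn : 0 < n)
    [Flat (Hom.toSchemeHom ((n : ℤ) • 𝟙 A))] [Surjective (Hom.toSchemeHom ((n : ℤ) • 𝟙 A))]
    [Finite (A.torsionPoints K n)]
    (hdeg : Module.finrank A.X.left.functionField
      (FunctionFieldOver (Hom.toSchemeHom ((n : ℤ) • 𝟙 A))) = Nat.card (A.torsionPoints K n))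
    {I : Type*} (s : Finset I) (E : I → CartierDivisor A.X.left)
    (hE : ∀ i ∈ s, ((E i).pullback (Hom.toSchemeHom ((n : ℤ) • 𝟙 A))).LinEquiv 0)
    (hne : ∀ i ∈ s, ∀ j ∈ s, (E i).LinEquiv (E j) → i = j) :
    s.card ≤ Nat.card (A.torsionPoints K n) := by
  classical
  -- trivializers and characters
  have htriv : ∀ i : s, ∃ h, A.IsTrivializer (n := n) (E i) h := fun i =>
    A.exists_isTrivializer (hE i.1 i.2)
  choose h hh using htriv
  let χ : s → (A.torsionPoints K n →* (A.X.left.functionField)ˣ) := fun i => kummerChar (hh i)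
  have hχ : Function.Injective χ := fun i j hij =>
    Subtype.ext (hne i.1 i.2 j.1 j.2 (linEquiv_of_kummerChar_eq hn hdeg (hh i) (hh j) hij))
  haveI : Finite (A.torsionPoints K n →* (A.X.left.functionField)ˣ) := by
    haveI := Fintype.ofFinite (A.torsionPoints K n)
    have hli := linearIndependent_monoidHom (A.torsionPoints K n) A.X.left.functionField
    haveI : Finite (A.torsionPoints K n →* A.X.left.functionField) := hli.finite
    exact Finite.of_injective (fun χ => (Units.coeHom _).comp χ) (fun χ χ' e => by
      ext g; exact congrArg (fun φ : A.torsionPoints K n →* A.X.left.functionField => φ g) e)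
  calc s.card = Nat.card s := (Nat.card_eq_finsetCard s).symm
    _ ≤ Nat.card (A.torsionPoints K n →* (A.X.left.functionField)ˣ) :=
        Nat.card_le_card_of_injective χ hχ
    _ ≤ Nat.card (A.torsionPoints K n) := natCard_monoidHom_units_le _

end Kummer

end AbelianVariety

end Literature.AlgebraicGeometry.Motives
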